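import Summits.QuantumFields.YangMills.Theorems.BalabanLadderROTTiltBracketStep
import HarnessLib

/-!
# Crux `ROT` (stmt-QuantumFields-20042): the tilt bracket `TI` from exponential decay of boundary influence in units `a`

Helper file of the fleet lead `ym-spine-20042-p1` (generation g4), `--supports stmt-QuantumFields-20042` (count-neutral).  Fourth file
of the series p480022 (`…SkewTorusDLR`) → p481311 (`…TiltBracketKernel`) → `…TiltBracketStep` → here: the passage along admissible schemes.

WHAT.  `TiltInsensitivityOn G r a t.tiltCell (fittedClass t.q)` (the infrared half of the recorded split v5″,
`Theorems/BalabanLadderROTTiltSplit.lean` p469977: along every admissible scheme in units `a` on the fitted class `q ∣ 2L+1`, the centred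
`n`-point distributions of the action density on the TILTED torus `ℤ⁴/m·rotZinv(ℤ⁴)` and on the STRAIGHT torus `ℤ⁴/(2L+1)ℤ⁴` agree in the
limit on King's class) FOLLOWS from ONE infrared input, stated inline (no definition is introduced; naming it is the owner's call):

  **exponential decay of boundary influence in units `a`** — there are `c₆ > 0`, `β₆`, `K₆` such that for `β ≥ β₆`, every cube
  `(c, b)` of `ℤ⁴`, every depth `d`, every two exteriors `η, η'` and every bounded continuous cylinder observable `A` (`|A| ≤ M`) whose
  support edges have base points of depth `≥ d` in the cube,
  `|kerE η A − kerE η' A| ≤ K₆ · M · b⁴ · exp(−c₆ · a(β) · d)`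
  (tree vocabulary `kerE`/`cubeEdges`/`depth` of `Theorems/LangevinControlUVOSLegsFromFemtoAndGapDefs.lean`; an input of MASS-GAP type —
  `c₆ a(β)` in lattice units is the rate `c₆` in physical units — NOT supplied by the crux's `GapInUnits` (two-point clustering on straight
  tori); it is what a cluster expansion / complete analyticity at the crossover scale would deliver).

HOW.  `norm_tilt_bracket_step_le` (one step `k`: cube of radius `R = L_k/4`, depth `d = R/2`; the test function only sees multi-sites
with coordinates `≤ ρ/a_k ≤ R/2` once `a_k L_k ≥ 8ρ + 8`, so both moment sums reduce to the box of radius `R+1` — representatives of BOTH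
cells — and the fixed-lattice theorem `PeriodCell.abs_moment_sub_moment_le` (p481311) applies):
`|TI bracket| ≤ E·b⁴·X·a_k⁻⁴ⁿ · (a_k⁴ⁿ Σ‖F(a_k x)‖)`; then `tendsto_boundary_rate` (`a_k⁻¹ ≤ a_k L_k =: t_k → ∞` makes the rate
`≤ const · t_k⁴ⁿ⁺⁸ e^{−c₆ t_k/8} → 0`) and the tree's `tendsto_riemann_sum` give `tiltInsensitivityOn_of_boundaryDecay`.

Nothing is asserted about the crux or about the truth of the infrared input; 0 definitions, 0 sorry.
References: C. King, Commun. Math. Phys. 103 (1986) II (2.25); H.-O. Georgii (2011) §8.2; S. Friedli, Y. Velenik (2017) §6.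
-/

set_option autoImplicit false

noncomputable section

open scoped SchwartzMap BigOperators
open MeasureTheory Filter Topology Metric
open Literature.MathematicalPhysics.QuantumFieldTheory Literature.MathematicalPhysics.QuantumLattice
open Literature.MathematicalPhysics.AQFT
open Literature.Probability.LatticeModels (box Site mem_box box_mono)
open Summit.QuantumFields.YangMills.Cruxes.OSLegsFromFemtoAndGap.DlrCollarTransfer
open Summit.QuantumFields.YangMills.Cruxes.OSLegsFromFemtoAndGap.DlrCollarTransfer.StubLower (cubeEdges_window le_depth_cube)
open Summit.QuantumFields.YangMills.Cruxes.OSLegsAtWeakCouplingC.Sketch (tendsto_riemann_sum)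
open Summit.QuantumFields.YangMills.Cruxes.OSLegsAtWeakCouplingC.Y2Bridge
open Summit.QuantumFields.YangMills.Theorems.OSLegsFromFemtoAndGap (latticeDist mul_norm_le_norm_smul_siteToE)
open Summit.QuantumFields.YangMills.Theorems.OSLegsFromFemtoAndGap.StubLower
  (curvature_supp_window curvature_shift_supp_window exists_abs_curvature_le exists_near_of_mem_plaquetteEdges_touching)
open Summit.QuantumFields.YangMills.Theorems.NPointIsotropy.Negative (E4)

namespace Summit.QuantumFields.YangMills.Theorems.ROT

open PythTriple

/-! ## §1 The rate: `b_k⁴ e^{−c a_k d_k} a_k⁻⁴ⁿ → 0` along admissible schemes -/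

/-- **The boundary rate beats the field renormalisation.**  For positive `a_k ≤ 1` with `a_k⁻² ≤ L_k` and `a_k L_k → ∞`, cube sides
`b_k = 2⌊L_k/4⌋ + 1` and depths `d_k = ⌊⌊L_k/4⌋/2⌋`:  `E · b_k⁴ · exp(−c a_k d_k) · a_k^{-m} → 0` (`c > 0`), because with `t_k = a_k L_k`
one has `a_k⁻¹ ≤ t_k`, `L_k ≤ t_k²`, `d_k ≥ L_k/8 − 1`, so the quantity is `≤ 16|E|e^{c} · t_k^{m+8} e^{−(c/8) t_k}`. -/
theorem tendsto_boundary_rate (as : ℕ → ℝ) (Ls : ℕ → ℕ) (hapos : ∀ k, 0 < as k) (ha1 : ∀ k, as k ≤ 1)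
    (hLa : ∀ k, (as k)⁻¹ * (as k)⁻¹ ≤ Ls k) (haL : Tendsto (fun k => as k * (Ls k : ℝ)) atTop atTop)
    {c : ℝ} (hc : 0 < c) (E : ℝ) (m : ℕ) :
    Tendsto (fun k => E * ((2 * (Ls k / 4) + 1 : ℕ) : ℝ) ^ 4 * Real.exp (-(c * as k * ((Ls k / 4 / 2 : ℕ) : ℝ))) *
      (as k)⁻¹ ^ m) atTop (𝓝 0) := by
  -- the comparison function `g(t) = t^{m+8} e^{-(c/8) t}` tends to `0` at `+∞`
  have hg : Tendsto (fun x : ℝ => x ^ (((m + 8 : ℕ) : ℝ)) * Real.exp (-(c / 8) * x)) atTop (𝓝 0) :=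
    tendsto_rpow_mul_exp_neg_mul_atTop_nhds_zero _ _ (by positivity)
  have hg' : Tendsto (fun k => (16 * |E| * Real.exp c) *
      ((as k * (Ls k : ℝ)) ^ (((m + 8 : ℕ) : ℝ)) * Real.exp (-(c / 8) * (as k * (Ls k : ℝ))))) atTop (𝓝 0) := by
    simpa using (hg.comp haL).const_mul (16 * |E| * Real.exp c)
  refine squeeze_zero_norm' ?_ hg'
  filter_upwards [haL.eventually_ge_atTop 1] with k hk1
  set t : ℝ := as k * (Ls k : ℝ) with ht
  have ha := hapos k
  have ht0 : 0 < t := lt_of_lt_of_le one_pos hk1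
  -- `a⁻¹ ≤ t`, `L ≤ t²`
  have hainv : (as k)⁻¹ ≤ t := by
    have h := hLa k
    have h' : (as k)⁻¹ * (as k)⁻¹ * as k ≤ (Ls k : ℝ) * as k := mul_le_mul_of_nonneg_right h ha.le
    rw [mul_assoc, inv_mul_cancel₀ ha.ne', mul_one] at h'
    linarith [mul_comm (Ls k : ℝ) (as k)]
  have hLt : (Ls k : ℝ) ≤ t ^ 2 := by
    have : (Ls k : ℝ) = t * (as k)⁻¹ := by rw [ht]; field_simp
    rw [this, pow_two]
    exact mul_le_mul_of_nonneg_left hainv ht0.le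
  -- `b ≤ 2 t²` hence `b⁴ ≤ 16 t⁸`
  have hL1 : (1 : ℝ) ≤ Ls k := by
    have h1 : (1 : ℝ) ≤ (as k)⁻¹ := one_le_inv_iff₀.2 ⟨ha, ha1 k⟩
    have h2 : (1 : ℝ) ≤ (as k)⁻¹ * (as k)⁻¹ := by nlinarith
    exact h2.trans (hLa k)
  have hb : ((2 * (Ls k / 4) + 1 : ℕ) : ℝ) ≤ 2 * t ^ 2 := by
    have h1 : ((2 * (Ls k / 4) + 1 : ℕ) : ℝ) ≤ (Ls k : ℝ) + 1 := by
      have : 2 * (Ls k / 4) + 1 ≤ Ls k + 1 := by omega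
      exact_mod_cast this
    linarith
  have hb4 : ((2 * (Ls k / 4) + 1 : ℕ) : ℝ) ^ 4 ≤ 16 * t ^ 8 := by
    have h0 : (0 : ℝ) ≤ ((2 * (Ls k / 4) + 1 : ℕ) : ℝ) := by positivity
    calc ((2 * (Ls k / 4) + 1 : ℕ) : ℝ) ^ 4 ≤ (2 * t ^ 2) ^ 4 := pow_le_pow_left₀ h0 hb 4
      _ = 16 * t ^ 8 := by ring
  -- `d ≥ L/8 - 1`, hence `exp(-c a d) ≤ e^{c} e^{-(c/8) t}`
  have hd : (Ls k : ℝ) / 8 - 1 ≤ ((Ls k / 4 / 2 : ℕ) : ℝ) := by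
    rw [Nat.div_div_eq_div_mul]
    have h := Nat.lt_div_mul_add (a := Ls k) (b := 8) (by norm_num)
    have h' : (Ls k : ℝ) < ((Ls k / 8 : ℕ) : ℝ) * 8 + 8 := by exact_mod_cast h
    linarith
  have hexp : Real.exp (-(c * as k * ((Ls k / 4 / 2 : ℕ) : ℝ))) ≤ Real.exp c * Real.exp (-(c / 8) * t) := by
    rw [← Real.exp_add, Real.exp_le_exp]
    have h1 : c * as k * ((Ls k : ℝ) / 8 - 1) ≤ c * as k * ((Ls k / 4 / 2 : ℕ) : ℝ) :=
      mul_le_mul_of_nonneg_left hd (by positivity)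
    have h2 : c * as k ≤ c := by nlinarith [ha1 k]
    have h3 : c * as k * ((Ls k : ℝ) / 8 - 1) = c / 8 * t - c * as k := by rw [ht]; ring
    linarith
  -- `a^{-m} ≤ t^m`
  have ham : (as k)⁻¹ ^ m ≤ t ^ m := pow_le_pow_left₀ (inv_nonneg.2 ha.le) hainv m
  -- assemble
  have hpow : t ^ (((m + 8 : ℕ) : ℝ)) = t ^ 8 * t ^ m := by
    rw [Real.rpow_natCast, pow_add, mul_comm]
  rw [Real.norm_eq_abs, hpow]
  calc |E * ((2 * (Ls k / 4) + 1 : ℕ) : ℝ) ^ 4 * Real.exp (-(c * as k * ((Ls k / 4 / 2 : ℕ) : ℝ))) * (as k)⁻¹ ^ m|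
      = |E| * ((2 * (Ls k / 4) + 1 : ℕ) : ℝ) ^ 4 * Real.exp (-(c * as k * ((Ls k / 4 / 2 : ℕ) : ℝ))) * (as k)⁻¹ ^ m := by
        rw [abs_mul, abs_mul, abs_mul, abs_of_nonneg (by positivity : (0 : ℝ) ≤ ((2 * (Ls k / 4) + 1 : ℕ) : ℝ) ^ 4),
          abs_of_pos (Real.exp_pos _), abs_of_nonneg (pow_nonneg (inv_nonneg.2 ha.le) m)]
    _ ≤ |E| * (16 * t ^ 8) * (Real.exp c * Real.exp (-(c / 8) * t)) * t ^ m := by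
        gcongr
    _ = 16 * |E| * Real.exp c * (t ^ 8 * t ^ m * Real.exp (-(c / 8) * t)) := by ring

/-! ## §2 The per-step estimate and `TI` -/

section Main

variable {G : Type} [Group G] [TopologicalSpace G] [IsTopologicalGroup G] [CompactSpace G]
  [MeasurableSpace G] [BorelSpace G]

/-- **The tilt bracket at one step of a scheme.**  At inverse coupling `β` where the boundary-decay input holds (with factor `X ≥ 0` in
place of `exp(−c₆ a(β) d)`, `d = ⌊⌊L/4⌋/2⌋`), torus half-side `L` in the fitted class (`L ≥ 14`), spacing `0 < a₀ ≤ 1`, and a test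
function `F` supported in the ball of radius `ρ` with `8ρ + 8 ≤ a₀ L`: the difference of the centred `n`-point distributions of the action
density on the tilted and on the straight torus of side `2L+1` at `F` is at most `E · b⁴ · X · a₀⁻⁴ⁿ · (a₀⁴ⁿ Σ_{x ∈ box^n} ‖F(a₀x)‖)`,
`b = 2⌊L/4⌋+1`, `E = 2·max(K₆,0)(2B)ⁿ + n(2B)ⁿ⁻¹·2·max(K₆,0)B`. -/
theorem norm_tilt_bracket_step_le (t : PythTriple) (r : LatticeRep G) (β : ℝ) {K₆ X : ℝ} (hX : 0 ≤ X) {L : ℕ}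
    (hdecβ : ∀ (c : Fin 4 → ℤ) (b : ℕ) (η η' : LGConfig 4 G) (A : LGConfig 4 G → ℝ) (M : ℝ)
      (S : Finset (Literature.MathematicalPhysics.QuantumLattice.ZdEdge 4)),
      Continuous A → (∀ U, |A U| ≤ M) → IsCylinder A S → (∀ e ∈ S, L / 4 / 2 ≤ depth c b e.1) →
      |kerE G r β c b η A - kerE G r β c b η' A| ≤ K₆ * M * (b : ℝ) ^ 4 * X)
    (hL : L ∈ fittedClass t.q) (hL14 : 14 ≤ L) {a₀ : ℝ} (ha : 0 < a₀) (ha1 : a₀ ≤ 1)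
    {B : ℝ} (hB0 : 0 ≤ B) (hB : ∀ (z : Site 4) (U : LGConfig 4 G), |r.curvature.F (configShift (-z) U)| ≤ B)
    {n : ℕ} (F : 𝓢((Fin n → E4), ℂ)) {ρ : ℝ}
    (hρ : tsupport (F : (Fin n → E4) → ℂ) ⊆ closedBall (0 : Fin n → E4) ρ) (hρL : 8 * ρ + 8 ≤ a₀ * L) :
    ‖(t.tiltCell L).dist r.ρ β (fun x => a₀ • siteToE x) r.curvature.F ((t.tiltCell L).mean r.ρ β r.curvature.F) n F -
        (axisCell L).dist r.ρ β (fun x => a₀ • siteToE x) r.curvature.F ((axisCell L).mean r.ρ β r.curvature.F) n F‖ ≤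
      (2 * (max K₆ 0 * (2 * B) ^ n) + n * (2 * B) ^ (n - 1) * (2 * (max K₆ 0 * B))) * ((2 * (L / 4) + 1 : ℕ) : ℝ) ^ 4 * X *
        a₀⁻¹ ^ (4 * n) *
        (a₀ ^ (4 * n) * ∑ x ∈ Fintype.piFinset (fun _ : Fin n => box 4 L), ‖F (fun i => a₀ • siteToE (x i))‖) := by
  haveI := r.secondCountableTopology
  have hOB : ∀ U, |r.curvature.F U| ≤ B := fun U => by
    have h := hB 0 U
    have e : configShift (-(0 : Site 4)) U = U := by
      funext e'; rw [configShift_apply, neg_zero, sub_zero]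
    rwa [e] at h
  -- the cube of radius `R = L/4` around the origin
  obtain ⟨R, hR⟩ : ∃ R : ℕ, R = L / 4 := ⟨_, rfl⟩
  have hR4 : 4 * (R + 1) < 2 * L + 1 := by omega
  have hRL : R + 1 ≤ L := by omega
  have hRreal : (L : ℝ) / 4 - 1 ≤ R := by
    have h := Nat.lt_div_mul_add (a := L) (b := 4) (by norm_num)
    have h' : (L : ℝ) < ((L / 4 : ℕ) : ℝ) * 4 + 4 := by exact_mod_cast h
    rw [hR]; linarith
  have hR0 : (0 : ℝ) ≤ R := Nat.cast_nonneg _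
  have hρR : ρ / a₀ ≤ (R : ℝ) / 2 := by
    rw [div_le_iff₀ ha]
    have h1 : a₀ * ((L : ℝ) / 4 - 1) ≤ a₀ * R := mul_le_mul_of_nonneg_left hRreal ha.le
    nlinarith
  have hdR : ((L / 4 / 2 : ℕ) : ℝ) ≤ (R : ℝ) - ρ / a₀ := by
    have h1 : ((L / 4 / 2 : ℕ) : ℝ) ≤ (R : ℝ) / 2 := by rw [← hR]; exact Nat.cast_div_le
    linarith
  have hm₁B : |(t.tiltCell L).mean r.ρ β r.curvature.F| ≤ B := (t.tiltCell L).abs_mean_le r.ρ r.continuous β hOB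
  -- representatives
  have hboxT : box 4 (R + 1) ⊆ (t.tiltCell L).reps := box_subset_tiltCell_reps t hL hR4
  have hboxS : box 4 (R + 1) ⊆ (axisCell L).reps := by rw [axisCell_reps]; exact box_mono 4 hRL
  -- multi-sites seen by `F`
  have hxsmall : ∀ x : Fin n → Site 4, F (fun i => a₀ • siteToE (x i)) ≠ 0 → ∀ i j, |((x i j : ℤ) : ℝ)| ≤ ρ / a₀ :=
    fun x hx i j => abs_coord_le_of_apply_ne_zero F hρ ha x hx i j
  have hxint : ∀ x : Fin n → Site 4, F (fun i => a₀ • siteToE (x i)) ≠ 0 → ∀ i j, |x i j| ≤ (R : ℤ) := by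
    intro x hx i j
    have h : |((x i j : ℤ) : ℝ)| ≤ (R : ℝ) := ((hxsmall x hx i j).trans hρR).trans (by linarith)
    rw [← Int.cast_abs] at h
    exact_mod_cast h
  have hvanish : ∀ x : Fin n → Site 4, x ∉ Fintype.piFinset (fun _ : Fin n => box 4 (R + 1)) →
      F (fun i => a₀ • siteToE (x i)) = 0 := by
    intro x hx
    by_contra hne
    obtain ⟨i, hi⟩ : ∃ i, x i ∉ box 4 (R + 1) := not_forall.1 fun h => hx (Fintype.mem_piFinset.2 h)
    obtain ⟨j, hj⟩ := exists_abs_ge_of_notMem_box hi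
    have h1 := hxint x hne i j
    push_cast at hj
    linarith
  -- both moment sums reduce to the box of radius `R + 1`
  have huT : Fintype.piFinset (fun _ : Fin n => box 4 (R + 1)) ⊆ Fintype.piFinset (fun _ : Fin n => (t.tiltCell L).reps) :=
    Fintype.piFinset_subset _ _ fun _ => hboxT
  have huS : Fintype.piFinset (fun _ : Fin n => box 4 (R + 1)) ⊆ Fintype.piFinset (fun _ : Fin n => (axisCell L).reps) :=
    Fintype.piFinset_subset _ _ fun _ => hboxS
  have huL : Fintype.piFinset (fun _ : Fin n => box 4 (R + 1)) ⊆ Fintype.piFinset (fun _ : Fin n => box 4 L) :=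
    Fintype.piFinset_subset _ _ fun _ => box_mono 4 hRL
  have eT : (t.tiltCell L).dist r.ρ β (fun x => a₀ • siteToE x) r.curvature.F ((t.tiltCell L).mean r.ρ β r.curvature.F) n F =
      ∑ x ∈ Fintype.piFinset (fun _ : Fin n => box 4 (R + 1)),
        (((t.tiltCell L).moment r.ρ β r.curvature.F ((t.tiltCell L).mean r.ρ β r.curvature.F) x : ℝ) : ℂ) *
          F (fun i => a₀ • siteToE (x i)) := by
    rw [PeriodCell.dist_apply]
    exact (Finset.sum_subset huT fun x _ hxu => by simp only [hvanish x hxu, mul_zero]).symm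
  have eS : (axisCell L).dist r.ρ β (fun x => a₀ • siteToE x) r.curvature.F ((axisCell L).mean r.ρ β r.curvature.F) n F =
      ∑ x ∈ Fintype.piFinset (fun _ : Fin n => box 4 (R + 1)),
        (((axisCell L).moment r.ρ β r.curvature.F ((axisCell L).mean r.ρ β r.curvature.F) x : ℝ) : ℂ) *
          F (fun i => a₀ • siteToE (x i)) := by
    rw [PeriodCell.dist_apply]
    exact (Finset.sum_subset huS fun x _ hxu => by simp only [hvanish x hxu, mul_zero]).symm
  -- the fixed-lattice theorem at every multi-site seen by `F`
  have hd0 : L / 4 / 2 ≤ R := by rw [hR]; exact Nat.div_le_self _ _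
  have hW : ∀ x : Fin n → Site 4, F (fun i => a₀ • siteToE (x i)) ≠ 0 →
      |(t.tiltCell L).moment r.ρ β r.curvature.F ((t.tiltCell L).mean r.ρ β r.curvature.F) x -
          (axisCell L).moment r.ρ β r.curvature.F ((axisCell L).mean r.ρ β r.curvature.F) x| ≤
        (2 * (max K₆ 0 * (2 * B) ^ n) + n * (2 * B) ^ (n - 1) * (2 * (max K₆ 0 * B))) * ((2 * R + 1 : ℕ) : ℝ) ^ 4 * X := by
    intro x hx
    have hA := PeriodCell.abs_moment_sub_moment_le (t.tiltCell L) (axisCell L) r β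
      (cubeEdges (fun j => (0 : Fin 4 → ℤ) j - R) (2 * R + 1)) x hB
      (fun z hz => hboxT (basePoints_subset_box r R x (hxint x hx) hz))
      (fun z hz => hboxS (basePoints_subset_box r R x (hxint x hx) hz))
      (kernel_osc_curvature r β hX R (L / 4 / 2) hdecβ hB0 hOB hd0)
      (kernel_osc_prod r β hX R (L / 4 / 2) hdecβ hB0 hOB hm₁B hdR x (hxsmall x hx))
    calc _ ≤ _ := hA
      _ = _ := by ring
  -- the estimate
  have hcoefR : 0 ≤ (2 * (max K₆ 0 * (2 * B) ^ n) + n * (2 * B) ^ (n - 1) * (2 * (max K₆ 0 * B))) *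
      ((2 * R + 1 : ℕ) : ℝ) ^ 4 * X := by positivity
  have hinv : a₀⁻¹ ^ (4 * n) * a₀ ^ (4 * n) = 1 := by
    rw [inv_pow, inv_mul_cancel₀ (pow_ne_zero _ ha.ne')]
  rw [← hR]
  calc ‖(t.tiltCell L).dist r.ρ β (fun x => a₀ • siteToE x) r.curvature.F ((t.tiltCell L).mean r.ρ β r.curvature.F) n F -
        (axisCell L).dist r.ρ β (fun x => a₀ • siteToE x) r.curvature.F ((axisCell L).mean r.ρ β r.curvature.F) n F‖
      = ‖∑ x ∈ Fintype.piFinset (fun _ : Fin n => box 4 (R + 1)),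
          (((t.tiltCell L).moment r.ρ β r.curvature.F ((t.tiltCell L).mean r.ρ β r.curvature.F) x -
              (axisCell L).moment r.ρ β r.curvature.F ((axisCell L).mean r.ρ β r.curvature.F) x : ℝ) : ℂ) *
            F (fun i => a₀ • siteToE (x i))‖ := by
        rw [eT, eS, ← Finset.sum_sub_distrib]
        congr 1
        refine Finset.sum_congr rfl fun x _ => ?_
        push_cast; ring
    _ ≤ ∑ x ∈ Fintype.piFinset (fun _ : Fin n => box 4 (R + 1)),
          ‖(((t.tiltCell L).moment r.ρ β r.curvature.F ((t.tiltCell L).mean r.ρ β r.curvature.F) x -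
              (axisCell L).moment r.ρ β r.curvature.F ((axisCell L).mean r.ρ β r.curvature.F) x : ℝ) : ℂ) *
            F (fun i => a₀ • siteToE (x i))‖ := norm_sum_le _ _
    _ ≤ ∑ x ∈ Fintype.piFinset (fun _ : Fin n => box 4 (R + 1)),
          (2 * (max K₆ 0 * (2 * B) ^ n) + n * (2 * B) ^ (n - 1) * (2 * (max K₆ 0 * B))) * ((2 * R + 1 : ℕ) : ℝ) ^ 4 * X *
            ‖F (fun i => a₀ • siteToE (x i))‖ := by
        refine Finset.sum_le_sum fun x _ => ?_
        rw [norm_mul, Complex.norm_real, Real.norm_eq_abs]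
        by_cases hx : F (fun i => a₀ • siteToE (x i)) = 0
        · simp [hx]
        · exact mul_le_mul_of_nonneg_right (hW x hx) (norm_nonneg _)
    _ ≤ ∑ x ∈ Fintype.piFinset (fun _ : Fin n => box 4 L),
          (2 * (max K₆ 0 * (2 * B) ^ n) + n * (2 * B) ^ (n - 1) * (2 * (max K₆ 0 * B))) * ((2 * R + 1 : ℕ) : ℝ) ^ 4 * X *
            ‖F (fun i => a₀ • siteToE (x i))‖ :=
        Finset.sum_le_sum_of_subset_of_nonneg huL fun x _ _ => mul_nonneg hcoefR (norm_nonneg _)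
    _ = (2 * (max K₆ 0 * (2 * B) ^ n) + n * (2 * B) ^ (n - 1) * (2 * (max K₆ 0 * B))) * ((2 * R + 1 : ℕ) : ℝ) ^ 4 * X *
          a₀⁻¹ ^ (4 * n) * (a₀ ^ (4 * n) * ∑ x ∈ Fintype.piFinset (fun _ : Fin n => box 4 L),
            ‖F (fun i => a₀ • siteToE (x i))‖) := by
        rw [← Finset.mul_sum]
        calc (2 * (max K₆ 0 * (2 * B) ^ n) + n * (2 * B) ^ (n - 1) * (2 * (max K₆ 0 * B))) * ((2 * R + 1 : ℕ) : ℝ) ^ 4 * X *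
              ∑ x ∈ Fintype.piFinset (fun _ : Fin n => box 4 L), ‖F (fun i => a₀ • siteToE (x i))‖
            = (2 * (max K₆ 0 * (2 * B) ^ n) + n * (2 * B) ^ (n - 1) * (2 * (max K₆ 0 * B))) * ((2 * R + 1 : ℕ) : ℝ) ^ 4 * X *
              (a₀⁻¹ ^ (4 * n) * a₀ ^ (4 * n)) *
              ∑ x ∈ Fintype.piFinset (fun _ : Fin n => box 4 L), ‖F (fun i => a₀ • siteToE (x i))‖ := by
                rw [hinv, mul_one]
          _ = _ := by ring

/-! ## §3 `TI` from exponential decay of boundary influence in units `a` -/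

/-- **The tilt bracket vanishes along admissible schemes, given exponential decay of boundary influence in units `a`.**  For a
Pythagorean triple `t` (tilted tori `ℤ⁴/m·rotZinv(ℤ⁴)` on the fitted class `q ∣ 2L+1`), a lattice representation `r` and a unit map `a`:
if the lattice Yang–Mills cube kernels forget their boundary condition at the exponential rate `c₆ a(β)` per unit depth (uniformly in
`β ≥ β₆`, with the volume factor `b⁴`, for bounded continuous cylinder observables), then `TiltInsensitivityOn G r a t.tiltCell (fittedClass t.q)`:
the centred `n`-point distributions of the action density on the tilted and on the straight torus agree in the limit on King's class
(indeed on all compactly supported test functions), along every admissible scheme. -/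
theorem tiltInsensitivityOn_of_boundaryDecay (t : PythTriple) (r : LatticeRep G) (a : ℝ → ℝ)
    (hdecay : ∃ (c₆ β₆ K₆ : ℝ), 0 < c₆ ∧ ∀ β : ℝ, β₆ ≤ β →
      ∀ (c : Fin 4 → ℤ) (b d : ℕ) (η η' : LGConfig 4 G) (A : LGConfig 4 G → ℝ) (M : ℝ)
        (S : Finset (Literature.MathematicalPhysics.QuantumLattice.ZdEdge 4)),
        Continuous A → (∀ U, |A U| ≤ M) → IsCylinder A S → (∀ e ∈ S, d ≤ depth c b e.1) →
        |kerE G r β c b η A - kerE G r β c b η' A| ≤ K₆ * M * (b : ℝ) ^ 4 * Real.exp (-(c₆ * a β * d))) :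
    TiltInsensitivityOn G r a t.tiltCell (fittedClass t.q) := by
  obtain ⟨c₆, β₆, K₆, hc₆, hdec⟩ := hdecay
  intro sch hS hunits hβ hranges
  refine ⟨1, one_pos, fun n _hn F hF => ?_⟩
  obtain ⟨-, hFc, -, -⟩ := hF
  obtain ⟨B, hB0, hB⟩ := exists_abs_curvature_le r
  -- support radius of `F`
  obtain ⟨ρ, hρ0, hρ⟩ : ∃ ρ : ℝ, 0 ≤ ρ ∧ tsupport (F : (Fin n → E4) → ℂ) ⊆ closedBall (0 : Fin n → E4) ρ := by
    obtain ⟨ρ, hρ⟩ := hFc.isCompact.isBounded.subset_closedBall 0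
    exact ⟨max ρ 0, le_max_right _ _, hρ.trans (closedBall_subset_closedBall (le_max_left _ _))⟩
  -- scheme data
  have hapos : ∀ k, 0 < sch.a k := sch.a_pos
  have ha0 : Tendsto sch.a atTop (𝓝 0) := sch.tendsto_a
  have haL : Tendsto (fun k => sch.a k * (sch.L k : ℝ)) atTop atTop := sch.tendsto_L
  have ha1 : ∀ k, sch.a k ≤ 1 := fun k => (hranges k).2.1.trans (by norm_num)
  have hLa : ∀ k, (sch.a k)⁻¹ * (sch.a k)⁻¹ ≤ sch.L k := fun k => (hranges k).2.2.2
  -- the rate and the Riemann sums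
  have hrate := tendsto_boundary_rate sch.a sch.L hapos ha1 hLa haL hc₆
    (2 * (max K₆ 0 * (2 * B) ^ n) + n * (2 * B) ^ (n - 1) * (2 * (max K₆ 0 * B))) (4 * n)
  have hRiem : Tendsto (fun k => sch.a k ^ (4 * n) *
      ∑ x ∈ Fintype.piFinset (fun _ : Fin n => box 4 (sch.L k)), ‖F (fun i => sch.a k • siteToE (x i))‖)
      atTop (𝓝 (∫ y, ‖F y‖)) :=
    tendsto_riemann_sum (fun y => ‖F y‖) F.continuous.norm hFc.norm sch.a sch.L hapos ha0 haL
  -- the straight torus is the axis cell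
  have hS' : ∀ k, latticeDist r.ρ (sch.β k) (sch.L k) (sch.a k) r.curvature.F
      (wilsonTorusMean r.ρ (sch.β k) (sch.L k) r.curvature.F) n F =
      (axisCell (sch.L k)).dist r.ρ (sch.β k) (fun x => sch.a k • siteToE x) r.curvature.F
        ((axisCell (sch.L k)).mean r.ρ (sch.β k) r.curvature.F) n F := fun k => by
    rw [dist_axisCell, mean_axisCell]
  simp_rw [hS']
  -- squeeze against rate × Riemann sum
  have hlim := hrate.mul hRiem
  rw [zero_mul] at hlim
  refine squeeze_zero_norm' ?_ hlim
  filter_upwards [hβ.eventually_ge_atTop β₆, haL.eventually_ge_atTop (8 * ρ + 8)] with k hkβ hkL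
  have h := norm_tilt_bracket_step_le t r (sch.β k) (X := Real.exp (-(c₆ * a (sch.β k) * ((sch.L k / 4 / 2 : ℕ) : ℝ))))
    (Real.exp_pos _).le
    (fun c b η η' A M S hA hM hAS hd => hdec (sch.β k) hkβ c b (sch.L k / 4 / 2) η η' A M S hA hM hAS hd)
    (hS k) (hranges k).2.2.1 (hapos k) (ha1 k) hB0 hB F hρ hkL
  rw [← hunits k] at h
  exact h

end Main

end Summit.QuantumFields.YangMills.Theorems.ROT

end
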